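import Summits.NavierStokesRegularity.NavierStokesRegularity.Theses.TypeICertificateLadder
import Literature.Analysis.FluidPDE.SereginSverakScaledEnergyHolds

/-!
# Route TypeICertificateLadder — crux `NoTypeIBlowup` (item stmt-NavierStokesRegularity-1217):
# Seregin–Šverák's Lemma 3.5 WITHOUT axial symmetry, with explicit constants

Helper file (theorems only) towards the crux `NoTypeIBlowup` (symmetry-free Type I exclusion,
OPEN). Seregin–Šverák 2009 (Comm. PDE 34, arXiv:0804.1803), Lemma 3.5: under the assumptions of
their Thm. 3.1 — a distributional solution `(v, q)` of unit-viscosity Navier–Stokes in the unit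
cylinder `Q = 𝒞 × ]-1, 0[`, `v ∈ L³(Q)`, `q ∈ L^{3/2}(Q)`, axisymmetric, with the Type I bound
`√(-t)|v| ≤ K` — the scale-invariant energies `A + E + C + D` at the vertex are bounded on all
scales `0 < r < 1/4`. The tree discharges this as `SereginSverak2009.ScaledEnergyBound_holds`
over the hypothesis structure `IsAxisymmetricLocalSolution`, whose axisymmetry field is NEVER
USED by the discharged inputs: (as11) `lintegral_cube_le_of_typeI` (short-window absorption),
(as12) `dissipationE_add_energyA_le_of_suitable` (local energy inequality), (as13)
`seregin_sverak_pressure_decay_holds` (pressure decay, ball form) and the iteration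
`iterate_halving` / `decay_step_half` are all symmetry-free theorems of the tree.

This file re-assembles Lemma 3.5 at the vertex from those symmetry-free theorems, for a SUITABLE
weak solution in `Q` (which is what the zoom of a classical Leray–Hopf solution is), and with the
dependence of the bound made explicit — AFFINE in the data
`A(0, 3/4; v) + E(0, 3/4; ∇v) + D(0, 1; q)` with coefficients depending on the Type I constant
`K` only:

* `pressureD_decay_vertex` — (as13) at the vertex in the coordinate cylinders `𝒞` (the tree's
  transport `pressureDecay_of_seregin_sverak_pressure_decay` at `b = 0`, symmetry-free);
* `cubicC_absorb_vertex` — (as11) at the vertex from `lintegral_cube_le_of_typeI`;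
* `scaledEnergy_vertex_le_of_typeI` — the quantitative Lemma 3.5:
  `∀ K, ∃ a d, ∀ (v, q, G) suitable in Q with weak gradient G and √(-t)|v| ≤ K a.e.,
   ∀ r ∈ (0, 1/4), A(0,r) + E(0,r) + C(0,r) + D(0,r) ≤ a (A(0,3/4) + E(0,3/4) + D(0,1)) + d`.

Used by `TypeICertificateLadderNoTypeIBlowupTypeIMorrey.lean` to derive the Morrey-type bound of
a Type I classical solution UNIFORMLY over all centres (the data on the right are controlled by
the global energy, dissipation and `L^{3/2}` pressure norm), removing the hypothesis
`ScaledEnergyBound` (item 2884) from the reduction `¬ LocalTypeISingularityExists → NoTypeIBlowup`.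
-/

noncomputable section

namespace Summit.NavierStokesRegularity.NavierStokesRegularity.Theorems

open MeasureTheory Set Function Filter Topology TopologicalSpace Metric
open Literature.Analysis.FluidPDE Literature.Analysis.FluidPDE.SereginSverak2009
open scoped NNReal ENNReal

/-! ### (as13) at the vertex, coordinate cylinders -/

/-- **Seregin–Šverák 2009, (as13) at the vertex, symmetry-free**: there is a universal `c` such
that for every distributional solution `(v, q)` of unit-viscosity Navier–Stokes in the unit
cylinder `Q(0, 1)`, all `0 < r < 1/4` and `0 < ϱ ≤ r`,
`D(0, ϱ; q) ≤ c ((ϱ/r) D(0, r; q) + (r/ϱ)² C(0, r; v))`. This is the tree's transport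
`SereginSverak2009.pressureDecay_of_seregin_sverak_pressure_decay` of the proved ball form
`seregin_sverak_pressure_decay_holds` (Calderón–Zygmund at exponent `3/2`), specialised to the
axis parameter `b = 0`, whose proof uses only the distributional system (no axial symmetry).
[cite: SereginSverak2009, proof of Lemma 3.5, (as13) (arXiv p. 10)] -/
theorem pressureD_decay_vertex :
    ∃ c : ℝ≥0, ∀ (v : ℝ → EuclideanSpace ℝ (Fin 3) → EuclideanSpace ℝ (Fin 3))
      (q : ℝ → EuclideanSpace ℝ (Fin 3) → ℝ),
      IsDistributionalNSSolutionOn (parCylOpens 0 1) 1 0 v q →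
      ∀ r ∈ Ioo (0 : ℝ) (1 / 4), ∀ ϱ ∈ Ioc (0 : ℝ) r,
        pressureD ((0 : ℝ), (0 : ℝ) • eZ) ϱ q ≤
          c * (ENNReal.ofReal (ϱ / r) * pressureD ((0 : ℝ), (0 : ℝ) • eZ) r q +
            ENNReal.ofReal ((r / ϱ) ^ 2) * cubicC ((0 : ℝ), (0 : ℝ) • eZ) r v) := by
  obtain ⟨c, hc⟩ := seregin_sverak_pressure_decay_holds
  refine ⟨3 * c + 3, fun v q hdist r hr ϱ hϱ => ?_⟩
  have hb : |(0 : ℝ)| ≤ 1 / 4 := by norm_num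
  have hr0 : 0 < r := hr.1
  have hϱ0 : 0 < ϱ := hϱ.1
  have hϱr : ϱ ≤ r := hϱ.2
  set z : ℝ × EuclideanSpace ℝ (Fin 3) := ((0 : ℝ), (0 : ℝ) • eZ) with hz
  set D := pressureD z r q with hD
  set C := cubicC z r v with hC
  have hsubQ : parabolicCylinder r z ⊆ ((parCylOpens 0 1 : Opens (ℝ × EuclideanSpace ℝ (Fin 3))) :
      Set (ℝ × EuclideanSpace ℝ (Fin 3))) := by
    rw [coe_parCylOpens]
    exact parabolicCylinder_axis_subset_parCyl hb hr
  -- the common final bound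
  have hfinal : ∀ X : ℝ≥0∞,
      X ≤ 3 * ((c : ℝ≥0∞) * (ENNReal.ofReal (ϱ / r) * D)) + (c : ℝ≥0∞) * (ENNReal.ofReal ((r / ϱ) ^ 2) * C) +
        3 * (ENNReal.ofReal (ϱ / r) * D) →
      X ≤ ((3 * c + 3 : ℝ≥0) : ℝ≥0∞) * (ENNReal.ofReal (ϱ / r) * D + ENNReal.ofReal ((r / ϱ) ^ 2) * C) := by
    intro X hX
    refine hX.trans ?_
    push_cast
    have : (c : ℝ≥0∞) * (ENNReal.ofReal ((r / ϱ) ^ 2) * C) ≤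
        (3 * (c : ℝ≥0∞) + 3) * (ENNReal.ofReal ((r / ϱ) ^ 2) * C) := by
      refine mul_le_mul_left ?_ _
      calc (c : ℝ≥0∞) = 1 * c + 0 := by ring
        _ ≤ 3 * c + 3 := add_le_add (mul_le_mul_left (by norm_num) _) bot_le
    calc 3 * ((c : ℝ≥0∞) * (ENNReal.ofReal (ϱ / r) * D)) + (c : ℝ≥0∞) * (ENNReal.ofReal ((r / ϱ) ^ 2) * C) +
          3 * (ENNReal.ofReal (ϱ / r) * D)
        = (3 * (c : ℝ≥0∞) + 3) * (ENNReal.ofReal (ϱ / r) * D) +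
            (c : ℝ≥0∞) * (ENNReal.ofReal ((r / ϱ) ^ 2) * C) := by ring
      _ ≤ (3 * (c : ℝ≥0∞) + 3) * (ENNReal.ofReal (ϱ / r) * D) +
            (3 * (c : ℝ≥0∞) + 3) * (ENNReal.ofReal ((r / ϱ) ^ 2) * C) := add_le_add le_rfl this
      _ = (3 * (c : ℝ≥0∞) + 3) * (ENNReal.ofReal (ϱ / r) * D + ENNReal.ofReal ((r / ϱ) ^ 2) * C) := by ring
  by_cases hcase : Real.sqrt 2 * ϱ ≤ r
  · -- the ball estimate between the radii `√2 ϱ ≤ r`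
    have hs : 0 < Real.sqrt 2 * ϱ := by positivity
    have key := hc (parCylOpens 0 1) v q hdist z r (Real.sqrt 2 * ϱ) hs hcase hsubQ
    have e1 : 2 * ENNReal.ofReal (Real.sqrt 2 * ϱ / r) ≤ 3 * ENNReal.ofReal (ϱ / r) := by
      rw [← ENNReal.ofReal_ofNat 2, ← ENNReal.ofReal_ofNat 3, ← ENNReal.ofReal_mul (by norm_num),
        ← ENNReal.ofReal_mul (by norm_num)]
      exact ENNReal.ofReal_le_ofReal (two_mul_sqrt_two_ratio_le hϱ0.le hr0)
    have e2 : 2 * ENNReal.ofReal ((r / (Real.sqrt 2 * ϱ)) ^ 2) = ENNReal.ofReal ((r / ϱ) ^ 2) := by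
      rw [← ENNReal.ofReal_ofNat 2, ← ENNReal.ofReal_mul (by norm_num)]
      congr 1
      rw [div_pow, mul_pow, Real.sq_sqrt (by norm_num : (0 : ℝ) ≤ 2)]
      field_simp
    refine hfinal _ ?_
    calc pressureD z ϱ q
        ≤ 2 * cknD (Real.sqrt 2 * ϱ) z q := pressureD_le_two_mul_cknD z hϱ0 q
      _ ≤ 2 * ((c : ℝ≥0∞) * (ENNReal.ofReal (Real.sqrt 2 * ϱ / r) * cknD r z q +
            ENNReal.ofReal ((r / (Real.sqrt 2 * ϱ)) ^ 2) * cknC r z v)) := mul_le_mul_right key 2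
      _ ≤ 2 * ((c : ℝ≥0∞) * (ENNReal.ofReal (Real.sqrt 2 * ϱ / r) * D +
            ENNReal.ofReal ((r / (Real.sqrt 2 * ϱ)) ^ 2) * C)) := by
          gcongr
          · exact cknD_le_pressureD z r q
          · exact cknC_le_cubicC z r v
      _ = (c : ℝ≥0∞) * ((2 * ENNReal.ofReal (Real.sqrt 2 * ϱ / r)) * D) +
            (c : ℝ≥0∞) * ((2 * ENNReal.ofReal ((r / (Real.sqrt 2 * ϱ)) ^ 2)) * C) := by ring
      _ ≤ (c : ℝ≥0∞) * ((3 * ENNReal.ofReal (ϱ / r)) * D) +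
            (c : ℝ≥0∞) * (ENNReal.ofReal ((r / ϱ) ^ 2) * C) := by
          rw [e2]
          exact add_le_add (mul_le_mul_right (mul_le_mul_left e1 D) _) le_rfl
      _ = 3 * ((c : ℝ≥0∞) * (ENNReal.ofReal (ϱ / r) * D)) + (c : ℝ≥0∞) * (ENNReal.ofReal ((r / ϱ) ^ 2) * C) := by
          ring
      _ ≤ _ := le_self_add
  · -- `r < √2 ϱ`: trivially `D_𝒞(ϱ) ≤ (r/ϱ)² D_𝒞(r) ≤ 3 (ϱ/r) D_𝒞(r)`
    rw [not_le] at hcase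
    have e3 : ENNReal.ofReal ((r / ϱ) ^ 2) ≤ 3 * ENNReal.ofReal (ϱ / r) := by
      rw [← ENNReal.ofReal_ofNat 3, ← ENNReal.ofReal_mul (by norm_num)]
      refine ENNReal.ofReal_le_ofReal ?_
      have h1 : r / ϱ < Real.sqrt 2 := by rw [div_lt_iff₀ hϱ0]; linarith
      have h2 : (r / ϱ) ^ 2 < 2 := by
        have h0 : 0 ≤ r / ϱ := div_nonneg hr0.le hϱ0.le
        nlinarith [Real.sq_sqrt (show (0 : ℝ) ≤ 2 by norm_num), Real.sqrt_nonneg 2]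
      have hs : Real.sqrt 2 ≤ 3 / 2 := by
        rw [Real.sqrt_le_left (by norm_num)]
        norm_num
      have h3 : 2 ≤ 3 * (ϱ / r) := by
        rw [← mul_div_assoc, le_div_iff₀ hr0]
        nlinarith
      linarith
    refine hfinal _ ?_
    calc pressureD z ϱ q
        ≤ ENNReal.ofReal ((r / ϱ) ^ 2) * D := pressureD_le_sq_mul_pressureD z hϱ0 hϱr q
      _ ≤ (3 * ENNReal.ofReal (ϱ / r)) * D := mul_le_mul_left e3 D
      _ = 3 * (ENNReal.ofReal (ϱ / r) * D) := by ring
      _ ≤ _ := le_add_self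

/-! ### (as11) at the vertex -/

/-- **Seregin–Šverák 2009, (as11) at the vertex, symmetry-free** (short-window absorption of the
cubic term): if `√(-t)|v| ≤ K` a.e. on `Q(0, 1)` with `1 ≤ K`, `uncurry v` is a.e.-strongly
measurable there, and `0 < η ≤ 1`, then for `0 < r < 1/4`,
`C(0, r; v) ≤ (2Kη) A(0, r; v) + 8|B₁|K³η⁻³` (the tree's `lintegral_cube_le_of_typeI`
normalised by `r²`; the argument of `CubicAbsorption_holds` at `b = 0`).
[cite: SereginSverak2009, proof of Lemma 3.5, (as11) (arXiv p. 10)] -/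
theorem cubicC_absorb_vertex {v : ℝ → EuclideanSpace ℝ (Fin 3) → EuclideanSpace ℝ (Fin 3)}
    {K : ℝ} (hK : 0 ≤ K)
    (hv : AEStronglyMeasurable (uncurry v) (volume.restrict (parCyl 0 1)))
    (hI : ∀ᵐ z ∂(volume.restrict (parCyl 0 1)), Real.sqrt (-z.1) * ‖v z.1 z.2‖ ≤ K)
    {η : ℝ} (hη : 0 < η) (hη1 : η ≤ 1) {r : ℝ} (hr : r ∈ Ioo (0 : ℝ) (1 / 4)) :
    cubicC ((0 : ℝ), (0 : ℝ) • eZ) r v ≤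
      ENNReal.ofReal (2 * K * η) * energyA ((0 : ℝ), (0 : ℝ) • eZ) r v +
        ENNReal.ofReal (8 * K ^ 3 / η ^ 3) * volume (ball (0 : EuclideanSpace ℝ (Fin 3)) 1) := by
  have hb : |(0 : ℝ)| ≤ 1 / 4 := by norm_num
  have hsub : parCyl ((0 : ℝ), (0 : ℝ) • eZ) r ⊆ parCyl 0 1 :=
    parCyl_axis_subset hr.1.le (by rw [abs_zero]; linarith [hr.2])
  have hu : AEStronglyMeasurable (uncurry v) (volume.restrict (parCyl ((0 : ℝ), (0 : ℝ) • eZ) r)) :=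
    hv.mono_measure (Measure.restrict_mono hsub le_rfl)
  have hIb : ∀ᵐ z ∂(volume.restrict (parCyl ((0 : ℝ), (0 : ℝ) • eZ) r)),
      Real.sqrt (-z.1) * ‖v z.1 z.2‖ ≤ K :=
    ae_restrict_of_ae_restrict_of_subset hsub hI
  have hcore := lintegral_cube_le_of_typeI hr.1 hK hu hIb hη hη1
  set ρ : ℝ≥0∞ := ENNReal.ofReal r with hρ
  have hρ0 : ρ ≠ 0 := (ENNReal.ofReal_pos.2 hr.1).ne'
  have hρT : ρ ≠ ⊤ := ENNReal.ofReal_ne_top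
  have hρ2 : (ρ ^ 2)⁻¹ * ρ ^ 2 = 1 :=
    ENNReal.inv_mul_cancel (pow_ne_zero _ hρ0) (ENNReal.pow_ne_top hρT)
  calc cubicC ((0 : ℝ), (0 : ℝ) • eZ) r v
      = (ρ ^ 2)⁻¹ * ∫⁻ z in parCyl ((0 : ℝ), (0 : ℝ) • eZ) r, ‖v z.1 z.2‖ₑ ^ (3 : ℕ) := rfl
    _ ≤ (ρ ^ 2)⁻¹ * (ENNReal.ofReal (2 * K * η) * ρ ^ 2 * energyA ((0 : ℝ), (0 : ℝ) • eZ) r v +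
          ENNReal.ofReal (8 * K ^ 3 / η ^ 3) * ρ ^ 2 *
            volume (ball (0 : EuclideanSpace ℝ (Fin 3)) 1)) :=
        mul_le_mul' le_rfl hcore
    _ = (ρ ^ 2)⁻¹ * ρ ^ 2 * (ENNReal.ofReal (2 * K * η) * energyA ((0 : ℝ), (0 : ℝ) • eZ) r v +
          ENNReal.ofReal (8 * K ^ 3 / η ^ 3) * volume (ball (0 : EuclideanSpace ℝ (Fin 3)) 1)) := by
        ring
    _ = _ := by rw [hρ2, one_mul]

/-! ### Lemma 3.5 at the vertex with explicit constants -/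

/-- **Seregin–Šverák 2009, Lemma 3.5 at the vertex, WITHOUT axial symmetry and with explicit
constants.** For every Type I constant `K` there are `a, d ∈ ℝ≥0` (with `a` in fact universal)
such that: for every suitable weak solution `(v, q)` of unit-viscosity Navier–Stokes in the unit
cylinder `Q(0, 1) = 𝒞 × ]-1, 0[` (accepted `IsSuitableWeakSolutionOn`), with `v ∈ L³(Q)`, a weak
spatial gradient `G` on `Q`, and the a.e. Type I bound `√(-t)|v(t, x)| ≤ K` on `Q`, one has for
all `0 < r < 1/4`
`A(0, r; v) + E(0, r; G) + C(0, r; v) + D(0, r; q) ≤ a · (A(0, 3/4; v) + E(0, 3/4; G) + D(0, 1; q)) + d`.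
Proof = the printed iteration (arXiv p. 10) as in the tree's `ScaledEnergyBound.of_inputs`, at
`b = 0`: (as12) from `dissipationE_add_energyA_le_of_suitable`, (as13) from
`pressureD_decay_vertex`, (as11) from `cubicC_absorb_vertex` with the window `η = min 1 (ε/2K̂)`,
`K̂ = max K 1`, the contraction `decay_step_half`, `iterate_halving` from the top scales
`ϑ/4 ≤ r < 1/4` (where `Q(0, r) ⊆ Q(0, 3/4) ⊆ Q`), and (as11) once more for `C`. Nothing here is
specific to axisymmetric fields. [cite: SereginSverak2009, Lemma 3.5 and its proof (arXiv pp. 9–10)] -/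
theorem scaledEnergy_vertex_le_of_typeI (K : ℝ) :
    ∃ a d : ℝ≥0, ∀ (v : ℝ → EuclideanSpace ℝ (Fin 3) → EuclideanSpace ℝ (Fin 3))
      (q : ℝ → EuclideanSpace ℝ (Fin 3) → ℝ)
      (G : ℝ → EuclideanSpace ℝ (Fin 3) → EuclideanSpace ℝ (Fin 3) →L[ℝ] EuclideanSpace ℝ (Fin 3)),
      IsSuitableWeakSolutionOn (parCylOpens 0 1) 1 0 v q →
      (∫⁻ z in parCyl 0 1, ‖v z.1 z.2‖ₑ ^ (3 : ℕ) < ∞) →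
      HasWeakSpatialGradientOn (parCylOpens 0 1) v G →
      (∀ᵐ z ∂(volume.restrict (parCyl 0 1)), Real.sqrt (-z.1) * ‖v z.1 z.2‖ ≤ K) →
      ∀ r ∈ Ioo (0 : ℝ) (1 / 4),
        energyA 0 r v + dissipationE 0 r G + cubicC 0 r v + pressureD 0 r q ≤
          a * (energyA 0 (3 / 4) v + dissipationE 0 (3 / 4) G + pressureD 0 1 q) + d := by
  obtain ⟨c₁₂, h12⟩ := dissipationE_add_energyA_le_of_suitable
  obtain ⟨c₁₃, h13⟩ := pressureD_decay_vertex
  -- constants depending on `c₁₂, c₁₃` only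
  set L : ℝ≥0 := max c₁₂ c₁₃ with hL
  have hL12 : (c₁₂ : ℝ≥0∞) ≤ L := ENNReal.coe_le_coe.2 (le_max_left _ _)
  have hL13 : (c₁₃ : ℝ≥0∞) ≤ L := ENNReal.coe_le_coe.2 (le_max_right _ _)
  obtain ⟨ϑ, hϑ0, hϑ4, hLϑ⟩ := exists_ratio (2 * L ^ 2 + L)
  obtain ⟨ε, hε0, hLε⟩ := exists_parameter ((6 * L + L ^ 2) * (2 * ϑ)⁻¹ ^ 2)
  have hϑR : (0 : ℝ) < ϑ := by exact_mod_cast hϑ0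
  have hϑR4 : 4 * (ϑ : ℝ) ≤ 1 := by exact_mod_cast hϑ4
  have hϑ1R : (ϑ : ℝ) < 1 := by linarith
  -- the Type I constant made `≥ 1`, the window `η` and the constant `F` of (as11)
  set Kh : ℝ := max K 1 with hKh
  have hKh0 : 0 < Kh := lt_of_lt_of_le one_pos (le_max_right _ _)
  have hε0R : (0 : ℝ) < ε := by exact_mod_cast hε0
  set η : ℝ := min 1 ((ε : ℝ) / (2 * Kh)) with hη
  have hη0 : 0 < η := lt_min one_pos (by positivity)
  have hη1 : η ≤ 1 := min_le_left _ _
  have hKη : 2 * Kh * η ≤ ε := by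
    calc 2 * Kh * η ≤ 2 * Kh * ((ε : ℝ) / (2 * Kh)) := by gcongr; exact min_le_right _ _
      _ = ε := by field_simp
  have hV : volume (ball (0 : EuclideanSpace ℝ (Fin 3)) 1) ≠ ⊤ := measure_ball_lt_top.ne
  set V : ℝ≥0 := (volume (ball (0 : EuclideanSpace ℝ (Fin 3)) 1)).toNNReal with hVdef
  have hVcoe : (V : ℝ≥0∞) = volume (ball (0 : EuclideanSpace ℝ (Fin 3)) 1) :=
    ENNReal.coe_toNNReal hV
  set F : ℝ≥0 := Real.toNNReal (8 * Kh ^ 3 / η ^ 3) * V with hF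
  have hFcoe :
      ENNReal.ofReal (8 * Kh ^ 3 / η ^ 3) * volume (ball (0 : EuclideanSpace ℝ (Fin 3)) 1) = F := by
    rw [hF, ENNReal.coe_mul, hVcoe]
    rfl
  have ha : ENNReal.ofReal (2 * Kh * η) ≤ ε := by
    rw [← ENNReal.ofReal_coe_nnreal]; exact ENNReal.ofReal_le_ofReal hKη
  -- the top scales `r₀ ≤ r < 1/4`, `r₀ = ϑ/4`, and the affine coefficients
  set r₀ : ℝ := (ϑ : ℝ) * (1 / 4) with hr₀
  have hr₀0 : 0 < r₀ := by positivity
  set B : ℝ≥0 := (6 * L + L ^ 2) * (2 * ϑ)⁻¹ ^ 2 * F + L * (2 * ϑ)⁻¹ ^ 2 with hB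
  set a₀ : ℝ≥0 := Real.toNNReal ((3 / 4) / r₀) + Real.toNNReal ((1 / r₀) ^ 2) with ha₀
  refine ⟨(1 + ε) * a₀, (1 + ε) * (2 * B) + F, ?_⟩
  -- the solution
  intro v q G hsw hv3 hG hIK r hr
  have hdist := hsw.distributional
  have hb : |(0 : ℝ)| ≤ 1 / 4 := by norm_num
  set z : ℝ × EuclideanSpace ℝ (Fin 3) := ((0 : ℝ), (0 : ℝ) • eZ) with hz
  have hz0 : z = 0 := by rw [hz, zero_smul]; rfl
  -- Type I with the constant `Kh ≥ K`, measurability, local integrability of `|v|³`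
  have hI : ∀ᵐ w ∂(volume.restrict (parCyl 0 1)), Real.sqrt (-w.1) * ‖v w.1 w.2‖ ≤ Kh :=
    hIK.mono fun w hw => hw.trans (le_max_left _ _)
  have hvm : AEStronglyMeasurable (uncurry v) (volume.restrict (parCyl 0 1)) := by
    have := hdist.1.aestronglyMeasurable
    rwa [coe_parCylOpens] at this
  have hv3loc : LocallyIntegrableOn (fun w : ℝ × EuclideanSpace ℝ (Fin 3) => ‖v w.1 w.2‖ ^ 3)
      ((parCylOpens 0 1 : Opens (ℝ × EuclideanSpace ℝ (Fin 3))) : Set (ℝ × EuclideanSpace ℝ (Fin 3)))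
      volume := by
    refine IntegrableOn.locallyIntegrableOn ⟨?_, ?_⟩
    · rw [coe_parCylOpens]; exact hvm.norm.pow 3
    · rw [hasFiniteIntegral_iff_enorm, coe_parCylOpens]
      refine lt_of_le_of_lt (le_of_eq (lintegral_congr fun w => ?_)) hv3
      rw [Real.enorm_eq_ofReal (by positivity), ENNReal.ofReal_pow (norm_nonneg _), ofReal_norm]
  -- the data bound `M` on the top scales
  set M : ℝ≥0∞ := ENNReal.ofReal ((3 / 4) / r₀) * (energyA 0 (3 / 4) v + dissipationE 0 (3 / 4) G) +
    ENNReal.ofReal ((1 / r₀) ^ 2) * pressureD 0 1 q with hM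
  -- (as11) at all scales `(0, 1/4)`
  have h11 : ∀ s ∈ Ioo (0 : ℝ) (1 / 4), cubicC z s v ≤
      ε * (dissipationE z s G + energyA z s v) + F := by
    intro s hs
    calc cubicC z s v ≤ ENNReal.ofReal (2 * Kh * η) * energyA z s v +
          ENNReal.ofReal (8 * Kh ^ 3 / η ^ 3) * volume (ball (0 : EuclideanSpace ℝ (Fin 3)) 1) :=
          cubicC_absorb_vertex hKh0.le hvm hI hη0 hη1 hs
      _ = ENNReal.ofReal (2 * Kh * η) * energyA z s v + F := by rw [hFcoe]
      _ ≤ ε * (dissipationE z s G + energyA z s v) + F :=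
          add_le_add (mul_le_mul' ha le_add_self) le_rfl
  -- `ℰ ≤ M + 2B` on `(0, 1/4)`
  have hΦ : ∀ s ∈ Ioo (0 : ℝ) (1 / 4),
      dissipationE z s G + energyA z s v + pressureD z s q ≤ M + 2 * B := by
    intro s hs
    refine iterate_halving (Φ := fun s => dissipationE z s G + energyA z s v + pressureD z s q)
      (R := 1 / 4) hϑR hϑ1R hr₀0 le_rfl ?_ ?_ hs.1 hs.2
    · -- the contraction `ℰ(ϑ s) ≤ ½ ℰ(s) + B`
      intro s hs0 hsR
      refine decay_step_half (E := fun s => dissipationE z s G) (A := fun s => energyA z s v)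
        (C := fun s => cubicC z s v) (D := fun s => pressureD z s q) hϑ0 hϑ4 hLϑ hLε h11
        (fun s hs => ?_) (fun s hs κ hκ hκ1 => ?_)
        (fun s hs κ hκ hκ1 => cubicC_mul_le _ v hs.1 hκ hκ1) ⟨hs0, hsR⟩
      · have hsub : parCyl z s ⊆ ((parCylOpens 0 1 : Opens (ℝ × EuclideanSpace ℝ (Fin 3))) :
            Set (ℝ × EuclideanSpace ℝ (Fin 3))) := by
          rw [coe_parCylOpens]
          exact parCyl_axis_subset hs.1.le (by rw [abs_zero]; linarith [hs.2])
        exact (h12 _ v q G hsw hv3loc hG z s hs.1 hsub).trans (by gcongr)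
      · exact (pressureD_mul_le_of_decay (h13 v q hdist) hs hκ hκ1).trans (by gcongr)
    · -- the top scales, through `Q(0, s) ⊆ Q(0, 3/4) ⊆ Q`
      intro s h1 h2
      have hs0 : 0 < s := hr₀0.trans_le h1
      have hbs : |(0 : ℝ)| + s ≤ 3 / 4 := by rw [abs_zero]; linarith
      have hbs1 : |(0 : ℝ)| + s ≤ 1 := by rw [abs_zero]; linarith
      have hsub := parCyl_axis_subset hs0.le hbs
      have hsub1 := parCyl_axis_subset hs0.le hbs1
      have hE : dissipationE z s G ≤ ENNReal.ofReal ((3 / 4) / r₀) * dissipationE 0 (3 / 4) G :=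
        (dissipationE_le_of_subset hs0 (by norm_num) hsub).trans (by gcongr)
      have hA : energyA z s v ≤ ENNReal.ofReal ((3 / 4) / r₀) * energyA 0 (3 / 4) v := by
        have ht : Ioo (z.1 - s ^ 2) z.1 ⊆
            Ioo ((0 : ℝ × EuclideanSpace ℝ (Fin 3)).1 - (3 / 4) ^ 2) (0 : ℝ × EuclideanSpace ℝ (Fin 3)).1 := by
          refine Ioo_subset_Ioo ?_ (by rw [hz0])
          rw [hz0]
          simp only [Prod.fst_zero]
          nlinarith
        have hx : spaceCyl z.2 s ⊆ spaceCyl (0 : ℝ × EuclideanSpace ℝ (Fin 3)).2 (3 / 4) :=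
          spaceCyl_axis_subset hbs
        exact (energyA_le_of_subset hs0 (by norm_num) ht hx).trans (by gcongr)
      have hD : pressureD z s q ≤ ENNReal.ofReal ((1 / r₀) ^ 2) * pressureD 0 1 q :=
        (pressureD_le_of_subset hs0 (by norm_num) hsub1).trans (by gcongr)
      calc dissipationE z s G + energyA z s v + pressureD z s q
          ≤ ENNReal.ofReal ((3 / 4) / r₀) * dissipationE 0 (3 / 4) G +
            ENNReal.ofReal ((3 / 4) / r₀) * energyA 0 (3 / 4) v +
            ENNReal.ofReal ((1 / r₀) ^ 2) * pressureD 0 1 q := add_le_add (add_le_add hE hA) hD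
        _ = M := by rw [hM]; ring
  -- `M ≤ a₀ · (A + E + D)`
  have hMa : M ≤ (a₀ : ℝ≥0∞) * (energyA 0 (3 / 4) v + dissipationE 0 (3 / 4) G + pressureD 0 1 q) := by
    have e1 : ENNReal.ofReal ((3 / 4) / r₀) ≤ (a₀ : ℝ≥0∞) := by
      show ((Real.toNNReal ((3 / 4) / r₀) : ℝ≥0) : ℝ≥0∞) ≤ _
      rw [ha₀, ENNReal.coe_add]
      exact le_self_add
    have e2 : ENNReal.ofReal ((1 / r₀) ^ 2) ≤ (a₀ : ℝ≥0∞) := by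
      show ((Real.toNNReal ((1 / r₀) ^ 2) : ℝ≥0) : ℝ≥0∞) ≤ _
      rw [ha₀, ENNReal.coe_add]
      exact le_add_self
    calc M = ENNReal.ofReal ((3 / 4) / r₀) * (energyA 0 (3 / 4) v + dissipationE 0 (3 / 4) G) +
          ENNReal.ofReal ((1 / r₀) ^ 2) * pressureD 0 1 q := rfl
      _ ≤ (a₀ : ℝ≥0∞) * (energyA 0 (3 / 4) v + dissipationE 0 (3 / 4) G) +
          (a₀ : ℝ≥0∞) * pressureD 0 1 q :=
          add_le_add (mul_le_mul' e1 le_rfl) (mul_le_mul' e2 le_rfl)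
      _ = (a₀ : ℝ≥0∞) * (energyA 0 (3 / 4) v + dissipationE 0 (3 / 4) G + pressureD 0 1 q) := by ring
  -- conclusion at the given `r`
  have h1 := hΦ r hr
  have h2 := h11 r hr
  rw [hz0] at h1 h2
  set X := energyA 0 (3 / 4) v + dissipationE 0 (3 / 4) G + pressureD 0 1 q with hX
  calc energyA 0 r v + dissipationE 0 r G + cubicC 0 r v + pressureD 0 r q
      = (dissipationE 0 r G + energyA 0 r v + pressureD 0 r q) + cubicC 0 r v := by ring
    _ ≤ (M + 2 * B) + (ε * (dissipationE 0 r G + energyA 0 r v) + F) := add_le_add h1 h2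
    _ ≤ (M + 2 * B) + (ε * (M + 2 * B) + F) := by
        have hEA : dissipationE 0 r G + energyA 0 r v ≤ M + 2 * B := le_self_add.trans h1
        gcongr (M + 2 * (B : ℝ≥0∞)) + ((ε : ℝ≥0∞) * ?_ + (F : ℝ≥0∞))
    _ = (1 + ε) * M + ((1 + ε) * (2 * B) + F) := by ring
    _ ≤ (1 + ε) * ((a₀ : ℝ≥0∞) * X) + ((1 + ε) * (2 * B) + F) := by gcongr
    _ = (((1 + ε) * a₀ : ℝ≥0) : ℝ≥0∞) * X + (((1 + ε) * (2 * B) + F : ℝ≥0) : ℝ≥0∞) := by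
        push_cast; ring

end Summit.NavierStokesRegularity.NavierStokesRegularity.Theorems

end
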